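import Summits.ResolutionOfSingularities.ResolutionOfSingularities.Theorems.DeepCrossCutKernels2
import Summits.ResolutionOfSingularities.ResolutionOfSingularities.Theorems.CrossCutLaw2
import HarnessLib

/-!
# DeepCrossCutKernelsCross — decomp-res node «DeepCrossCut» §Y.0 RING KERNELS vs the CROSS weight (lens-2 g21 rev7)

Content VERBATIM from §Y.0 (ring level) and the inhabitant kernels of the decomp-res lens-2 g21 node
`HOME/decomp-res-lens-2/g21/DeepCrossCut.lean`
(rev7, pin 607dfe85, 5 760 l; HOME = run/shared/lean/pub/decomp-res); CRITIC-LEDGER row 168 (RIDERS: the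
scheme-level §Y — engines `DeepCrossExit` /
`NodeExit`, the deep leaf, `Deep.closes`, the re-location of `Cross.CrossSpecialRung` — is HELD until the critic's
(d′) window closes and is NOT in
these files); landing orders INBOX :712 (the §Y.0 decl list) + :770 (rev7 additions `deepNewt` …
`deepCrossNewtShape_insepVV7`).  The node's
l. 132–4440 restate the earlier lens-2 nodes VERBATIM and are DELETED here (landed as `PinchCut…` / `JetCut…` /
`PurityCut…` / `SplitCut…` /
`CylinderCut…` / `SpreadCut…` / `CrossCut…`; never two copies); these ring kernels are CommRing-generic and import
only the top of the
landed lens-2 column (`SplitCutKernels2`) for the opened namespaces; the FOUR comparison lemmas with g20's `crossWt`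
/ `CrossShape`
(`deepWt_le_crossWt`, `crossWt_le_deepWt_self`, `deepCrossShape_self_iff`, `crossShape_of_deepCrossNewtShape_self`)
wait for `CrossCutLaw2` to land and
follow VERBATIM in `DeepCrossCutKernelsCross.lean` (dependency split, critic INBOX :799 «LAND NOW»).  Namespace
`…Theorems.DeepCrossCut` (the lens's `Theses.DeepCrossCut` is gate-reserved);
sections `DeepRing` ⊃ `NodeKernel`, `DeepKernel` and `InhabitantKernel`, the `variable` line, `open MvPolynomial`
and every declaration exactly as
in the lens; file split only (tree files ≤ 400 lines).  RING KERNELS ONLY: PROVED identities and monomial-ideal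
bookkeeping (0 sorry) + the two
named inhabitants INSEP-vv7 = `z² + u₁⁵ + v²u₂⁷ /𝔽₂` (chart by chart) and the nodal `N`; no scheme-level statement,
no engine, no aside, no
route edit.  All `--supports stmt-ResolutionOfSingularities-29273` (`MaxContactCut.RungOne`, the lens-2 column
root); nothing closes it.

THE FOUR COMPARISON LEMMAS of §Y.0 with g20's cross weight, VERBATIM: `deepWt_le_crossWt` (⊆),
`crossWt_le_deepWt_self` (= at `d = m`),
`deepCrossShape_self_iff` (`DeepCrossShape … q (2q+1) ↔ CrossShape … q`), `crossShape_of_deepCrossNewtShape_self`;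
typed over the landed `CrossCutLaw2`
(`…Theorems.CrossCut.crossWt` / `CrossShape`) and `DeepCrossCutKernels2` (dependency split of the §Y.0 kernels,
critic INBOX :799).

This file carries: `deepWt_le_crossWt`, `crossWt_le_deepWt_self`, `deepCrossShape_self_iff`,
`crossShape_of_deepCrossNewtShape_self`.

(Sources: Hironaka1967; CossartJannsenSaito2020 Ch. 2; CossartPiltant2008 Prop. 4.2; CossartPiltant2019 Rem. 3.2;
Hauser2010Kangaroo; Moh1987.)
-/

open CategoryTheory AlgebraicGeometry TopologicalSpace IsLocalRing
open Literature.AlgebraicGeometry.Resolution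
open Summit.ResolutionOfSingularities.ResolutionOfSingularities.Theorems
open Summit.ResolutionOfSingularities.ResolutionOfSingularities.Theorems.WeakOrderReduction
open Summit.ResolutionOfSingularities.ResolutionOfSingularities.Theorems.DeltaFaceCutClasses
open Summit.ResolutionOfSingularities.ResolutionOfSingularities.Theorems.RelativeDeltaCut
open Summit.ResolutionOfSingularities.ResolutionOfSingularities.Theorems.CurveLeafExit
open Summit.ResolutionOfSingularities.ResolutionOfSingularities.Theorems.PinchCut
open Summit.ResolutionOfSingularities.ResolutionOfSingularities.Theorems.JetCut
open Summit.ResolutionOfSingularities.ResolutionOfSingularities.Theorems.PurityCut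
open Summit.ResolutionOfSingularities.ResolutionOfSingularities.Theorems.SplitCut
open Summit.ResolutionOfSingularities.ResolutionOfSingularities.Theorems.CylinderCut
open Summit.ResolutionOfSingularities.ResolutionOfSingularities.Theorems.SpreadCut
open Summit.ResolutionOfSingularities.ResolutionOfSingularities.Theorems.CrossCut
open MvPolynomial

namespace Summit.ResolutionOfSingularities.ResolutionOfSingularities.Theorems.DeepCrossCut

section DeepRing

variable {R : Type} [CommRing R]

/-- The deep ideal lies in g20's cross ideal (forget the binomial-face weight).  KERNEL (PROVED). [folklore] -/
theorem deepWt_le_crossWt (c : Fin 4 → R) (q d l₁ l₂ l₃ : ℕ) : deepWt c q d l₁ l₂ l₃ ≤ crossWt c q l₁ l₂ := by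
  apply Ideal.span_mono
  rintro x ⟨i, a, b, e, hw₁, hw₂, -, rfl⟩
  exact ⟨i, a, b, e, hw₁, hw₂, rfl⟩

/-- At depth `d = m` the binomial-face weight is `m` times the steep weight, so g20's cross ideal lies in the deep
ideal whenever
`λ₃ ≤ m·λ₁`.  KERNEL (PROVED). [folklore] -/
theorem crossWt_le_deepWt_self (c : Fin 4 → R) (q l₁ l₂ l₃ : ℕ) (h : l₃ ≤ (2 * q + 1) * l₁) :
    crossWt c q l₁ l₂ ≤ deepWt c q (2 * q + 1) l₁ l₂ l₃ := by
  apply Ideal.span_mono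
  rintro x ⟨i, a, b, e, hw₁, hw₂, rfl⟩
  refine ⟨i, a, b, e, hw₁, hw₂, ?_, rfl⟩
  have key : (2 * q + 1) * (2 * q + 1) * i + 2 * (2 * q + 1) * a + 2 * (2 * q + 1) * b =
      (2 * q + 1) * ((2 * q + 1) * i + 2 * (a + b)) := by ring
  rw [key]
  exact le_trans h (Nat.mul_le_mul_left _ hw₁)

/-- **AT DEPTH `d = m` THE DEEP LETTER IS g20's CROSS LETTER** (consistency of the extension).  KERNEL (PROVED). [folklore] -/
theorem deepCrossShape_self_iff (J : Ideal R) (c : Fin 4 → R) (q : ℕ) :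
    DeepCrossShape J c q (2 * q + 1) ↔ CrossShape J c q := by
  constructor
  · rintro ⟨e₁, e₂, g, he₁, he₂, hg, hf, hJ⟩
    exact ⟨e₁, e₂, g, he₁, he₂, deepWt_le_crossWt c q _ _ _ _ hg, hf, le_trans hJ (deepWt_le_crossWt c q _ _ _ _)⟩
  · rintro ⟨e₁, e₂, g, he₁, he₂, hg, hf, hJ⟩
    refine ⟨e₁, e₂, g, he₁, he₂, crossWt_le_deepWt_self c q _ _ _ ?_ hg, hf,
      le_trans hJ (crossWt_le_deepWt_self c q _ _ _ ?_)⟩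
    · nlinarith
    · nlinarith

/-- At depth `d = m` a Newton-typed deep-cross letter is (in particular) g20's cross letter — one direction only:
the re-typed class at
`d = m` is a SUBCLASS of g20's cross class (contrast `deepCrossShape_self_iff`, Probe P25).  KERNEL (PROVED). [folklore] -/
theorem crossShape_of_deepCrossNewtShape_self {J : Ideal R} {c : Fin 4 → R} {q : ℕ}
    (h : DeepCrossNewtShape J c q (2 * q + 1)) : CrossShape J c q :=
  (deepCrossShape_self_iff J c q).mp (deepCrossNewtShape_to_deepCrossShape h)

end DeepRing

end Summit.ResolutionOfSingularities.ResolutionOfSingularities.Theorems.DeepCrossCut
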